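import Summits.CriticalPhenomena.PercolationContinuityZ3.Theorems.PercNearOneGluingNoHeavyLowerTailSahiOneStepHeavyVoterPrelim
import HarnessLib

/-!
# One-step scheme: `(2′)` and Kahn C5 / Sahi `C₃` for ONE-HEAVY-VOTER weighted thresholds against every increasing event

Prover prim-ineq-prove-3 gen 27 (`--supports stmt-CriticalPhenomena-4575`; memo
`run/shared/lean/prim/prim-ineq-prove-3/FINDING-G27-PIVOT-CERTIFICATE.md` §2).  No definitions, no sorries.

`B = (x_a ∧ {N_T ≥ m₁}) ∨ {N_T ≥ m₀}` (`m₁ ≤ m₀`, `a ∉ T`, `T ⊆ F`) = the weighted threshold `{(m₀−m₁)·x_a + N_T ≥ m₀}` (one heavy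
voter).  Its pivotal set at `a` is the BAND `{m₁ ≤ N_T < m₀}` — neither increasing nor decreasing, so neither literal step applies; the
good-pivot step (`osN_threshold_goodPivot_step`) does: the sections `{N_T ≥ m₁} ⊇ {N_T ≥ m₀}` are universal block thresholds (gen 20,
`osN_threshold_blockThreshold_nonneg`), the pivot helps `B` inside the ball (LEMMA X) and `Ψ ≥ 0` (`heavyVoter_psi`).  Results:
`osN_heavyVoter_nonneg` (`(2′)` against every increasing `A`, every product measure) and `sahiE3_heavyVoter_nonneg`
(`0 ≤ E₃(1_{N_F ≥ t}, 1_A, 1_B)`).  This is the case `K₁ = 1` of the three-chain-grid conjecture 3CG of gen 26.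
-/

noncomputable section

namespace Summit.CriticalPhenomena.PercolationContinuityZ3.Theorems

namespace SahiOneStep

open MeasureTheory Finset
open Literature.Probability.Percolation (DeterminedBy)
open Literature.Probability.LatticeModels (prodBernoulli sahiE3)
open Literature.Probability.Percolation.DecisionTree (ind)
open scoped Classical

variable {ι : Type*} [Fintype ι]

/-- **`(2′)` FOR THE ONE-HEAVY-VOTER WEIGHTED THRESHOLD `B = (x_a ∧ {N_T ≥ m₁}) ∨ {N_T ≥ m₀}` (`m₁ ≤ m₀`, `a ∉ T`, `T ⊆ F`)
against EVERY increasing `A`**, every slot level `t` and every product measure — the band step: at the pivot `a` the sections are the nested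
block thresholds `{N_T ≥ m₁} ⊇ {N_T ≥ m₀}`, which are universal (gen 20), the pivot helps `B` inside the ball (LEMMA X) and `Ψ ≥ 0`
(`heavyVoter_psi`); `a ∉ F` is a free step. [this work] -/
theorem osN_heavyVoter_nonneg (p : ι → unitInterval) (F : Finset ι) (t : ℕ) {T : Finset ι} {a : ι} (haT : a ∉ T) (hTF : T ⊆ F)
    {m₁ m₀ : ℕ} (hm : m₁ ≤ m₀) {A : Set (Set ι)} (hA : IsUpperSet A) :
    0 ≤ osN p {ω : Set ι | t ≤ (F.filter (· ∈ ω)).card} (ind A)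
      (ind (({ω : Set ι | a ∈ ω} ∩ {ω : Set ι | m₁ ≤ (T.filter (· ∈ ω)).card}) ∪ {ω : Set ι | m₀ ≤ (T.filter (· ∈ ω)).card})) := by
  set B : Set (Set ι) := ({ω : Set ι | a ∈ ω} ∩ {ω : Set ι | m₁ ≤ (T.filter (· ∈ ω)).card}) ∪
    {ω : Set ι | m₀ ≤ (T.filter (· ∈ ω)).card} with hB
  have hBup : IsUpperSet B :=
    IsUpperSet.union (IsUpperSet.inter (fun ω ω' (hle : ω ≤ ω') (h : a ∈ ω) => hle h) (isUpperSet_threshold T m₁))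
      (isUpperSet_threshold T m₀)
  -- sections of `B` at `a`
  have S1 : {ω : Set ι | insert a ω ∈ B} = {ω : Set ι | m₁ ≤ (T.filter (· ∈ ω)).card} := by
    ext ω
    have i1 := mem_iff_insert_mem_of_determinedBy (determinedBy_threshold T m₁) haT ω
    have i0 := mem_iff_insert_mem_of_determinedBy (determinedBy_threshold T m₀) haT ω
    have ha : a ∈ insert a ω := Set.mem_insert a ω
    have hsub : ω ∈ ({ω : Set ι | m₀ ≤ (T.filter (· ∈ ω)).card} : Set (Set ι)) → ω ∈ ({ω : Set ι | m₁ ≤ (T.filter (· ∈ ω)).card} : Set (Set ι)) :=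
      fun h0 => le_trans hm h0
    simp only [hB, Set.mem_setOf_eq, Set.mem_union, Set.mem_inter_iff, ha, true_and] at i1 i0 hsub ⊢
    rw [i1, i0]
    exact ⟨fun h => h.elim id hsub, fun h => Or.inl h⟩
  have S0 : {ω : Set ι | ω \ {a} ∈ B} = {ω : Set ι | m₀ ≤ (T.filter (· ∈ ω)).card} := by
    ext ω
    have i0 := sdiff_mem_iff_of_determinedBy (determinedBy_threshold T m₀) haT ω
    have hna : a ∉ ω \ {a} := fun h => h.2 rfl
    simp only [hB, Set.mem_setOf_eq, Set.mem_union, Set.mem_inter_iff, hna, false_and, false_or] at i0 ⊢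
    exact i0
  by_cases haF : a ∈ F
  · cases t with
    | zero => rw [threshold_zero, osN_ind_ind_univ]
    | succ t =>
      have hF : F = insert a (F.erase a) := (Finset.insert_erase haF).symm
      have hTF' : T ⊆ F.erase a := fun i hi => Finset.mem_erase.2 ⟨ne_of_mem_of_not_mem hi haT, hTF hi⟩
      rcases Nat.eq_or_lt_of_le hm with heq | hlt
      · -- `m₁ = m₀`: `B` is the block threshold itself
        subst heq
        have hBeq : B = {ω : Set ι | m₁ ≤ (T.filter (· ∈ ω)).card} := by
          ext ω; simp only [hB, Set.mem_union, Set.mem_inter_iff, Set.mem_setOf_eq]; tauto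
        rw [hBeq]
        exact osN_threshold_blockThreshold_nonneg p F (t + 1) _ T m₁ rfl hA
      · rw [hF]
        refine osN_threshold_goodPivot_step p (F.notMem_erase a) t hA hBup ?_ ?_ ?_ ?_ ?_
        · rw [S1]; exact osN_threshold_blockThreshold_nonneg p (F.erase a) t _ T m₁ rfl (isUpperSet_section_insert hA a)
        · rw [S0]; exact osN_threshold_blockThreshold_nonneg p (F.erase a) (t + 1) _ T m₀ rfl (isUpperSet_section_insert hA a)
        · rw [S0]; exact osN_threshold_blockThreshold_nonneg p (F.erase a) (t + 1) _ T m₀ rfl (isUpperSet_section_sdiff hA a)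
        · -- X̃ ≥ 0: LEMMA X for (m₀ − 1, m₀), then enlarge `{N_T ≥ m₀−1}` to `{N_T ≥ m₁}`
          rw [S0, S1]
          obtain ⟨m, rfl⟩ : ∃ m, m₀ = m + 1 := ⟨m₀ - 1, by omega⟩
          have hX := real_ball_mul_threshSucc_inter_ball_le p (F.erase a) hTF' m t
          have hmono : (prodBernoulli p).real ({ω : Set ι | m ≤ (T.filter (· ∈ ω)).card} ∩
              {ω : Set ι | ((F.erase a).filter (· ∈ ω)).card < t}) ≤
              (prodBernoulli p).real ({ω : Set ι | m₁ ≤ (T.filter (· ∈ ω)).card} ∩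
              {ω : Set ι | ((F.erase a).filter (· ∈ ω)).card < t}) :=
            measureReal_mono (Set.inter_subset_inter_left _ fun ω (hω : m ≤ (T.filter (· ∈ ω)).card) => by
              simp only [Set.mem_setOf_eq]; omega)
          exact hX.trans (mul_le_mul_of_nonneg_left hmono measureReal_nonneg)
        · rw [S0, S1]; exact heavyVoter_psi p (F.erase a) hTF' hm t
  · -- `a ∉ F`: free step, all four section pairs are (up-set, block threshold)
    refine osN_threshold_nonneg_of_sections p F t hA hBup haF ?_ ?_ ?_ ?_
    · rw [S1]; exact osN_threshold_blockThreshold_nonneg p F t _ T m₁ rfl (isUpperSet_section_insert hA a)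
    · rw [S0]; exact osN_threshold_blockThreshold_nonneg p F t _ T m₀ rfl (isUpperSet_section_sdiff hA a)
    · rw [S0]; exact osN_threshold_blockThreshold_nonneg p F t _ T m₀ rfl (isUpperSet_section_insert hA a)
    · rw [S1]; exact osN_threshold_blockThreshold_nonneg p F t _ T m₁ rfl (isUpperSet_section_sdiff hA a)

omit [Fintype ι] in
/-- Inner section of `({a ∈ ω} ∩ X) ∪ Y` at a coordinate `e ≠ a`. [folklore] -/
theorem section_insert_andOr {a e : ι} (hae : a ≠ e) (X Y : Set (Set ι)) :
    {ω : Set ι | insert e ω ∈ ({ω : Set ι | a ∈ ω} ∩ X) ∪ Y} =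
      ({ω : Set ι | a ∈ ω} ∩ {ω : Set ι | insert e ω ∈ X}) ∪ {ω : Set ι | insert e ω ∈ Y} := by
  ext ω
  simp only [Set.mem_setOf_eq, Set.mem_union, Set.mem_inter_iff, Set.mem_insert_iff, or_iff_right hae]

omit [Fintype ι] in
/-- Outer section of `({a ∈ ω} ∩ X) ∪ Y` at a coordinate `e ≠ a`. [folklore] -/
theorem section_sdiff_andOr {a e : ι} (hae : a ≠ e) (X Y : Set (Set ι)) :
    {ω : Set ι | ω \ {e} ∈ ({ω : Set ι | a ∈ ω} ∩ X) ∪ Y} =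
      ({ω : Set ι | a ∈ ω} ∩ {ω : Set ι | ω \ {e} ∈ X}) ∪ {ω : Set ι | ω \ {e} ∈ Y} := by
  ext ω
  simp only [Set.mem_setOf_eq, Set.mem_union, Set.mem_inter_iff, Set.mem_sdiff_singleton, ne_eq, hae, not_false_eq_true,
    and_true]

/-- **`(2′)` FOR ONE-HEAVY-VOTER WEIGHTED THRESHOLDS, ARBITRARY BLOCKS** (`T` need not lie inside the slot block `F`): for every product
measure, all finsets `F, T`, every `a ∉ T`, all `t`, `m₁ ≤ m₀` and EVERY increasing `A`,
`0 ≤ n(1_A, 1_B)` for the slot `{N_F ≥ t}` and `B = (x_a ∧ {N_T ≥ m₁}) ∨ {N_T ≥ m₀}` — the coordinates of `T ∖ F` are free for the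
slot and are peeled by `osN_threshold_nonneg_of_sections` (their sections stay in the family). [this work] -/
theorem osN_heavyVoter_universal (p : ι → unitInterval) (F : Finset ι) (t : ℕ) (a : ι) :
    ∀ (n : ℕ) (T : Finset ι) (m₁ m₀ : ℕ) {A : Set (Set ι)}, (T \ F).card = n → a ∉ T → m₁ ≤ m₀ → IsUpperSet A →
      0 ≤ osN p {ω : Set ι | t ≤ (F.filter (· ∈ ω)).card} (ind A)
        (ind (({ω : Set ι | a ∈ ω} ∩ {ω : Set ι | m₁ ≤ (T.filter (· ∈ ω)).card}) ∪ {ω : Set ι | m₀ ≤ (T.filter (· ∈ ω)).card})) := by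
  intro n
  induction n with
  | zero =>
    intro T m₁ m₀ A hT haT hm hA
    have hTF : T ⊆ F := by rw [Finset.card_eq_zero, Finset.sdiff_eq_empty_iff_subset] at hT; exact hT
    exact osN_heavyVoter_nonneg p F t haT hTF hm hA
  | succ n ih =>
    intro T m₁ m₀ A hT haT hm hA
    obtain ⟨e, he⟩ : (T \ F).Nonempty := by rw [← Finset.card_pos, hT]; exact Nat.succ_pos n
    have heT : e ∈ T := (Finset.mem_sdiff.1 he).1
    have heF : e ∉ F := (Finset.mem_sdiff.1 he).2
    have hae : a ≠ e := fun h => haT (h ▸ heT)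
    set T' : Finset ι := T.erase e with hT'
    have heT' : e ∉ T' := Finset.notMem_erase e T
    have hTins : T = insert e T' := by rw [hT', Finset.insert_erase heT]
    have haT' : a ∉ T' := fun h => haT (Finset.mem_of_mem_erase h)
    have hcard : (T' \ F).card = n := by
      have h1 : T' \ F = (T \ F).erase e := by
        ext i; simp only [hT', Finset.mem_sdiff, Finset.mem_erase]; tauto
      rw [h1, Finset.card_erase_of_mem he, hT]; omega
    have hBup : ∀ m m' : ℕ, IsUpperSet (({ω : Set ι | a ∈ ω} ∩ {ω : Set ι | m ≤ (T.filter (· ∈ ω)).card}) ∪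
        {ω : Set ι | m' ≤ (T.filter (· ∈ ω)).card}) := fun m m' =>
      IsUpperSet.union (IsUpperSet.inter (fun ω ω' (hle : ω ≤ ω') (h : a ∈ ω) => hle h) (isUpperSet_threshold T m))
        (isUpperSet_threshold T m')
    have hA1 : IsUpperSet {ω : Set ι | insert e ω ∈ A} := isUpperSet_section_insert hA e
    have hA0 : IsUpperSet {ω : Set ι | ω \ {e} ∈ A} := isUpperSet_section_sdiff hA e
    -- sections of the thresholds of `T = insert e T'`
    have sI : ∀ m : ℕ, {ω : Set ι | insert e ω ∈ {ω : Set ι | m + 1 ≤ (T.filter (· ∈ ω)).card}} =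
        {ω : Set ι | m ≤ (T'.filter (· ∈ ω)).card} := fun m => by rw [hTins]; exact section_insert_threshold heT' m
    have sO : ∀ m : ℕ, {ω : Set ι | ω \ {e} ∈ {ω : Set ι | m + 1 ≤ (T.filter (· ∈ ω)).card}} =
        {ω : Set ι | m + 1 ≤ (T'.filter (· ∈ ω)).card} := fun m => by rw [hTins]; exact section_sdiff_threshold heT' m
    have sI0 : {ω : Set ι | insert e ω ∈ {ω : Set ι | 0 ≤ (T.filter (· ∈ ω)).card}} = {ω : Set ι | 0 ≤ (T'.filter (· ∈ ω)).card} := by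
      ext ω; simp
    have sO0 : {ω : Set ι | ω \ {e} ∈ {ω : Set ι | 0 ≤ (T.filter (· ∈ ω)).card}} = {ω : Set ι | 0 ≤ (T'.filter (· ∈ ω)).card} := by
      ext ω; simp
    cases m₀ with
    | zero =>
      -- `m₁ = m₀ = 0`: `B = univ`
      have hm1 : m₁ = 0 := Nat.le_zero.1 hm
      subst hm1
      have hBu : (({ω : Set ι | a ∈ ω} ∩ {ω : Set ι | 0 ≤ (T.filter (· ∈ ω)).card}) ∪ {ω : Set ι | 0 ≤ (T.filter (· ∈ ω)).card}) =
          Set.univ := Set.eq_univ_of_forall fun ω => Or.inr (Nat.zero_le _)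
      rw [hBu, osN_ind_ind_univ_snd]
    | succ m₀ =>
      cases m₁ with
      | zero =>
        refine osN_threshold_nonneg_of_sections p F t hA (hBup 0 (m₀ + 1)) heF ?_ ?_ ?_ ?_
        · rw [section_insert_andOr hae, sI0, sI]; exact ih T' 0 m₀ hcard haT' (Nat.zero_le _) hA1
        · rw [section_sdiff_andOr hae, sO0, sO]; exact ih T' 0 (m₀ + 1) hcard haT' (Nat.zero_le _) hA0
        · rw [section_sdiff_andOr hae, sO0, sO]; exact ih T' 0 (m₀ + 1) hcard haT' (Nat.zero_le _) hA1
        · rw [section_insert_andOr hae, sI0, sI]; exact ih T' 0 m₀ hcard haT' (Nat.zero_le _) hA0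
      | succ m₁ =>
        have hm' : m₁ ≤ m₀ := Nat.succ_le_succ_iff.1 hm
        refine osN_threshold_nonneg_of_sections p F t hA (hBup (m₁ + 1) (m₀ + 1)) heF ?_ ?_ ?_ ?_
        · rw [section_insert_andOr hae, sI, sI]; exact ih T' m₁ m₀ hcard haT' hm' hA1
        · rw [section_sdiff_andOr hae, sO, sO]; exact ih T' (m₁ + 1) (m₀ + 1) hcard haT' hm hA0
        · rw [section_sdiff_andOr hae, sO, sO]; exact ih T' (m₁ + 1) (m₀ + 1) hcard haT' hm hA1
        · rw [section_insert_andOr hae, sI, sI]; exact ih T' m₁ m₀ hcard haT' hm' hA0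

/-- **KAHN C5 / SAHI `C₃` FOR {THRESHOLD SLOT, ARBITRARY INCREASING EVENT, ONE-HEAVY-VOTER WEIGHTED THRESHOLD}.**  For every product
measure, ALL finsets `F, T`, all `t`, `m₁ ≤ m₀`, every `a ∉ T` and EVERY increasing `A`:
`0 ≤ E₃(1_{N_F ≥ t}, 1_A, 1_{(x_a ∧ N_T ≥ m₁) ∨ N_T ≥ m₀})` — i.e. for the weighted threshold `{(m₀−m₁)·x_a + N_T ≥ m₀}`. [this work] -/
theorem sahiE3_heavyVoter_nonneg (p : ι → unitInterval) (F : Finset ι) (t : ℕ) {T : Finset ι} {a : ι} (haT : a ∉ T)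
    {m₁ m₀ : ℕ} (hm : m₁ ≤ m₀) {A : Set (Set ι)} (hA : IsUpperSet A) :
    0 ≤ sahiE3 (prodBernoulli p) {ω : Set ι | t ≤ (F.filter (· ∈ ω)).card} A
      (({ω : Set ι | a ∈ ω} ∩ {ω : Set ι | m₁ ≤ (T.filter (· ∈ ω)).card}) ∪ {ω : Set ι | m₀ ≤ (T.filter (· ∈ ω)).card}) := by
  have hB : IsUpperSet (({ω : Set ι | a ∈ ω} ∩ {ω : Set ι | m₁ ≤ (T.filter (· ∈ ω)).card}) ∪
      {ω : Set ι | m₀ ≤ (T.filter (· ∈ ω)).card}) :=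
    IsUpperSet.union (IsUpperSet.inter (fun ω ω' (hle : ω ≤ ω') (h : a ∈ ω) => hle h) (isUpperSet_threshold T m₁))
      (isUpperSet_threshold T m₀)
  rw [← osT_ind_ind, osT_eq_osMp_add_osN]
  exact add_nonneg (osMp_threshold_nonneg_all p F t hA hB) (osN_heavyVoter_universal p F t a _ T m₁ m₀ rfl haT hm hA)

end SahiOneStep

end Summit.CriticalPhenomena.PercolationContinuityZ3.Theorems
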